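import Summits.ResolutionOfSingularities.ResolutionOfSingularities.Theorems.GenericPointCutClasses
import Literature.AlgebraicGeometry.Resolution.BlowupDimension
import HarnessLib

/-!
# GenericFibreCutClasses — «a generic point of a fourfold is a closed point of a threefold over a function field»
(decomp-res node N47 «GenericFibreCut», lens-2 g8 = rev 2 of GenericPointCut; route-independent part, phase 1)

Source HOME/decomp-res-lens-2/g8/GenericFibreCut.lean (sha256 2531d302d09f5b30, 660 lines; critic `lean check` rc 0 ·
0 err · 0 warn · 0 sorry, `closes_mapEdge` axioms standard), CRITIC-LEDGER row 54 (2026-08-30T07:57Z): CLEARED AS MAP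
NODE rev 2 (map +1; `SeqDim 2 n` DECIDED = row-49 engine re-read; `ClosedCore 3 n` UNDECIDED, weaker by letter only,
= 30081 on imperfect fields; `ClosedPointCore` = `ClosedCore 4` the located residual, score 0; consolidation of rows
46/49/54 into one typed vocabulary accepted; p-rank ladder = located sharpening pending desk T-prank).

THE MOVE (g7 ⟶ g8). g7 (`GenericPointCutClasses`, landed) cut the dim-4 E-problem `SeqDimFour 1 n` by the
codimension in `Y` of the image of the top locus and fed the rounds by transversal engines on LOCAL schemes. g8
replaces «local scheme at the generic point» by «GENERIC FIBRE over a FUNCTION FIELD»: at a non-closed point `η` of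
codimension `c` the generic fibre of `U → 𝔸^{4-c}_k` is a regular finite-type scheme over `K = k(t₁,…,t_{4-c})` of
dimension `c` in which `η` is CLOSED — so the input a round needs is THE LADDER'S OWN FINITE-TYPE STATEMENT ONE
DIMENSION DOWN over ALL fields of characteristic `p` (a class closed under `K ↦ K(t)`), and the recursion closes
inside the tree's vocabulary:
* §1 `SeqDim d n` (weak order reduction, `dim Y ≤ d`, any field; `SeqDim 4 n ⟺ SeqDimFour 1 n`), `ReachClosed d n`
  (reach confinement of the top locus over CLOSED points), `ClosedCore d n` (the closed-point core in dimension `d`;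
  `ClosedCore 4 n ⟺ ClosedPointCore n`); EXACT in every dimension: `SeqDim d n ⟺ ReachClosed d n ∧ ClosedCore d n`;
  BY LETTER the rounds of dimension `d+1` contain the whole dimension-`d` problem (stalk dimension);
* §2 the DICTIONARY ports `DictThree n : SeqDim 3 n → ReachClosed 4 n`, `DictTwo n : SeqDim 2 n → ReachClosed 3 n`
  (EGA IV §8 spreading + CJS closures; costume by shape, counted 0; `DictThree` = cheap theorem #13) and
  `SurfacePort n : Cutkosky2009_thm_6_1 → SeqDim 2 n` (KNOWN-MOD-PORT(S));
* §3 the g8 pieces `GPieces n := SeqDim 2 n ∧ ClosedCore 3 n ∧ ClosedPointCore n` and the EXACT cut modulo the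
  dictionary `SeqDimFour 1 n ⟺ GPieces n`;
* §4 the p-RANK LADDER (`PRankLE`, `SeqDimP`, `ReachClosedP`, `ClosedCoreP`, graded ports): on the PERFECT column the
  whole imperfect-field input of the dim-4 E-problem is the threefold closed-point core over fields of p-RANK ONE.
The map edge BY NAME (30081 ⟹ `SeqDim 3 n`), the ladder links (29273 / 28544) and the route asides live in
`Theorems/MaxContactCutGenericFibreCut.lean` (phase 3). Sources: EGA IV₃ §8; Temkin arXiv:math/0703678 §2.3;
BierstoneGrigorievMilmanWlodarczyk2011 §3.3; Cutkosky2009 Thm 5.1 / 6.1 / Rem 6.2; CossartJannsenSaito2020 Thm 1.4 /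
Cor 1.5; CossartPiltant2019 Prop 4.3/4.4; BenitoVillamayor2012; Matsumura1987 §26. 0 sorry.
-/

open CategoryTheory AlgebraicGeometry
open Literature.AlgebraicGeometry.Resolution
open Summit.ResolutionOfSingularities.ResolutionOfSingularities.Theorems
open Summit.ResolutionOfSingularities.ResolutionOfSingularities.Theorems.WeakOrderReduction
open Summit.ResolutionOfSingularities.ResolutionOfSingularities.Theorems.GenericPointCutClasses

namespace Summit.ResolutionOfSingularities.ResolutionOfSingularities.Theorems.GenericFibreCutClasses

/-! ## §1 The dictionary's vocabulary: the ladder's own statements in EVERY dimension over EVERY field of char p -/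

/-- **`SeqDim d n`** — weak order reduction at marking `n` for ALL data on regular separated finite-type
quasi-compact `Y/k`, `k` ANY field of characteristic `p`, `dim Y ≤ d`.  `SeqDim 4 n` IS the tree's `SeqDimFour 1 n`
(`seqDim_four_iff`); `SeqDim 3 n` is fed BY NAME by lens-3's `MaxContactCut.MaxOrderThreefoldResolution` (stmt-30081;
`seqDim_three_of_item`); `SeqDim 2 n` is DECIDED (Cutkosky2009 Thm 6.1, tree `Cutkosky2009_thm_6_1`, via
`SurfacePort`). The class «all fields of char p» is closed under `K ↦ K(t)`, which is what lets the dictionary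
recurse. (Sources: Cutkosky2009 Thm 5.1, Thm 6.1; BenitoVillamayor2012; BierstoneGrigorievMilmanWlodarczyk2011
§3.1.) -/
def SeqDim (d n : ℕ) : Prop :=
  ∀ p : ℕ, p.Prime → ∀ (k : Type) [Field k] [CharP k p]
    (Y : Scheme.{0}) (g : Y ⟶ Spec (.of k)), IsSeparated g → LocallyOfFiniteType g → QuasiCompact g →
    Scheme.IsRegular Y → topologicalKrullDim Y ≤ ((d : ℕ) : WithBot ℕ∞) →
    ∀ I : Y.IdealSheafData, (∀ y : Y, idealOrder I y ≤ ((n : ℕ) : ℕ∞)) →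
      ∃ t : CentreSeq Y, WeakResolution t (⟨I, [], n⟩ : MarkedIdeal Y)

/-- **`ReachClosed d n`** — every datum `(Y, I, n)` with `dim Y ≤ d` admits a weakly admissible history after which
the top locus lies over points of `Y` of codimension `≥ d`, i.e. over finitely many CLOSED points with
`d`-dimensional local rings.  `ReachClosed 4 n ⟺ RoundCodimTwo n ∧ RoundCodimThree n` (`reachClosed_four_iff_rounds`).
Fed by the DICTIONARY from `SeqDim (d-1) n` (`DictThree`, `DictTwo`).
(Sources: arXiv:math/0703678 Prop 2.3.4; EGA IV-3 §8.) -/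
def ReachClosed (d n : ℕ) : Prop :=
  ∀ p : ℕ, p.Prime → ∀ (k : Type) [Field k] [CharP k p]
    (Y : Scheme.{0}) (g : Y ⟶ Spec (.of k)), IsSeparated g → LocallyOfFiniteType g → QuasiCompact g →
    Scheme.IsRegular Y → topologicalKrullDim Y ≤ ((d : ℕ) : WithBot ℕ∞) →
    ∀ I : Y.IdealSheafData, (∀ y : Y, idealOrder I y ≤ ((n : ℕ) : ℕ∞)) →
      ReachConfined I n d

/-- **`ClosedCore d n` — the CLOSED-POINT CORE in dimension `d`**: a datum on a `d`-fold (ANY field of char p) which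
admits a weakly admissible history confining its top locus over CLOSED points admits a weak resolution.
`ClosedCore 4 n ⟺ ClosedPointCore n` (g7's located residual); **`ClosedCore 3 n`** is the new piece of g8: UNDECIDED ·
WEAKER · the threefold closed-point core over an arbitrary (imperfect) field — weak order reduction of `(I, n)` near
finitely many closed points `y` of regular threefolds with `κ(y)/K` finite, `K` imperfect (p-rank ≥ 1 as soon as the
dictionary is used once).  In print: principal `I` (CJS 2020, any field), `n = 1` (CossartPiltant2019 4.3/4.4), `K
= k̄` (Cutkosky2009 5.1), `K` perfect (arXiv:1103.3464); general imperfect `K`: lens-3's port (ii) of stmt-30081 =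
g7's desk T-codim3 (DESK T-port-ii).  Fed BY NAME: 30081 ⟹ `SeqDim 3 n` ⟹ `ClosedCore 3 n`.
(Sources: Cutkosky2009 Thm 5.1; CossartPiltant2019 Prop 4.3/4.4; CossartJannsenSaito2020 Thm 1.4/6.9;
BenitoVillamayor2012.) -/
def ClosedCore (d n : ℕ) : Prop :=
  ∀ p : ℕ, p.Prime → ∀ (k : Type) [Field k] [CharP k p]
    (Y : Scheme.{0}) (g : Y ⟶ Spec (.of k)), IsSeparated g → LocallyOfFiniteType g → QuasiCompact g →
    Scheme.IsRegular Y → topologicalKrullDim Y ≤ ((d : ℕ) : WithBot ℕ∞) →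
    ∀ I : Y.IdealSheafData, (∀ y : Y, idealOrder I y ≤ ((n : ℕ) : ℕ∞)) →
      ReachConfined I n d → ∃ t : CentreSeq Y, WeakResolution t (⟨I, [], n⟩ : MarkedIdeal Y)

/-! ### Identifications with the tree / g7 (casts only) -/

/-- Reaching confinement is monotone in the codimension bound. [folklore] -/
theorem reachConfined_mono {Y : Scheme.{0}} (I : Y.IdealSheafData) (n : ℕ) {c c' : ℕ} (hcc : c ≤ c')
    (h : ReachConfined I n c') : ReachConfined I n c := by
  obtain ⟨t, hA, hC⟩ := h
  exact ⟨t, hA, confinedGE_mono _ _ hcc hC⟩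


/-- `SeqDim 4 n` IS `SeqDimFour 1 n` (class ≥ 1 is no condition). [folklore] -/
theorem seqDim_four_iff (n : ℕ) : SeqDim 4 n ↔ SeqDimFour 1 n := by
  constructor
  · intro h p hp k _ _ Y g hg1 hg2 hg3 hY hY4 I hord _
    exact h p hp k Y g hg1 hg2 hg3 hY (by exact_mod_cast hY4) I hord
  · intro h p hp k _ _ Y g hg1 hg2 hg3 hY hY4 I hord
    exact h p hp k Y g hg1 hg2 hg3 hY (by exact_mod_cast hY4) I hord fun y _ => classGE_one g hY I n y

/-- `ClosedCore 4 n` IS g7's `ClosedPointCore n`. [folklore] -/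
theorem closedCore_four_iff (n : ℕ) : ClosedCore 4 n ↔ ClosedPointCore n := by
  constructor
  · intro h p hp k _ _ Y g hg1 hg2 hg3 hY hY4 I hord hR
    exact h p hp k Y g hg1 hg2 hg3 hY (by exact_mod_cast hY4) I hord hR
  · intro h p hp k _ _ Y g hg1 hg2 hg3 hY hY4 I hord hR
    exact h p hp k Y g hg1 hg2 hg3 hY (by exact_mod_cast hY4) I hord hR

/-- `ReachClosed 4 n` IS the conjunction of g7's two rounds. [folklore] -/
theorem reachClosed_four_iff_rounds (n : ℕ) : ReachClosed 4 n ↔ RoundCodimTwo n ∧ RoundCodimThree n := by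
  refine ⟨fun h => ⟨?_, ?_⟩, fun h => ?_⟩
  · intro p hp k _ _ Y g hg1 hg2 hg3 hY hY4 I hord
    exact reachConfined_mono I n (by norm_num) (h p hp k Y g hg1 hg2 hg3 hY (by exact_mod_cast hY4) I hord)
  · intro p hp k _ _ Y g hg1 hg2 hg3 hY hY4 I hord _
    exact h p hp k Y g hg1 hg2 hg3 hY (by exact_mod_cast hY4) I hord
  · intro p hp k _ _ Y g hg1 hg2 hg3 hY hY4 I hord
    exact h.2 p hp k Y g hg1 hg2 hg3 hY (by exact_mod_cast hY4) I hord
      (h.1 p hp k Y g hg1 hg2 hg3 hY (by exact_mod_cast hY4) I hord)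

/-! ### Kernels in every dimension — pure logic -/

/-- Lower dimension is a sub-case. [folklore] -/
theorem seqDim_mono {c d n : ℕ} (hcd : c ≤ d) (h : SeqDim d n) : SeqDim c n := by
  intro p hp k _ _ Y g hg1 hg2 hg3 hY hYc I hord
  exact h p hp k Y g hg1 hg2 hg3 hY (hYc.trans (by exact_mod_cast hcd)) I hord

/-- By letter: the whole dimension-d problem gives its closed-point core. [folklore] -/
theorem closedCore_of_seqDim {d n : ℕ} (h : SeqDim d n) : ClosedCore d n := by
  intro p hp k _ _ Y g hg1 hg2 hg3 hY hYd I hord _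
  exact h p hp k Y g hg1 hg2 hg3 hY hYd I hord

/-- By letter: the whole dimension-d problem reaches closed-point confinement (a weak resolution is confined over
anything). [folklore] -/
theorem reachClosed_of_seqDim {d n : ℕ} (h : SeqDim d n) : ReachClosed d n := by
  intro p hp k _ _ Y g hg1 hg2 hg3 hY hYd I hord
  exact reachConfined_of_weakResolution I n d (h p hp k Y g hg1 hg2 hg3 hY hYd I hord)

/-- ASSEMBLY in dimension d: reaching closed-point confinement and the closed-point core give everything.
[folklore] -/
theorem seqDim_of_reachClosed_of_closedCore {d n : ℕ} (hR : ReachClosed d n) (hC : ClosedCore d n) : SeqDim d n := by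
  intro p hp k _ _ Y g hg1 hg2 hg3 hY hYd I hord
  exact hC p hp k Y g hg1 hg2 hg3 hY hYd I hord (hR p hp k Y g hg1 hg2 hg3 hY hYd I hord)

/-- **EXACTNESS in every dimension** (g7 is the case d = 4): the dimension-d problem IS «reach closed-point
confinement» ∧ «closed-point core». [folklore] -/
theorem seqDim_iff_reachClosed_and_closedCore (d n : ℕ) : SeqDim d n ↔ ReachClosed d n ∧ ClosedCore d n :=
  ⟨fun h => ⟨reachClosed_of_seqDim h, closedCore_of_seqDim h⟩,
    fun h => seqDim_of_reachClosed_of_closedCore h.1 h.2⟩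

/-! ### Stalk dimension: on a d-fold, confinement over codimension ≥ d+1 is an empty top locus -/

/-- The local rings of a scheme of dimension `≤ d` have dimension `≤ d` (tree `ringKrullDim_stalk_le_one`
generalised). [folklore] -/
theorem ringKrullDim_stalk_le_of_dim_le {Y : Scheme.{0}} {d : ℕ}
    (hdim : topologicalKrullDim Y ≤ ((d : ℕ) : WithBot ℕ∞)) (y : Y) :
    ringKrullDim (Y.presheaf.stalk y) ≤ ((d : ℕ) : WithBot ℕ∞) := by
  rw [ringKrullDim_stalk_eq_coheight]
  exact_mod_cast (topologicalKrullDim_le_iff_forall_coheight_le Y d).mp hdim y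

/-- On a scheme of dimension `≤ d`, a marked ideal confined over codimension `≥ d+1` has EMPTY support. [folklore] -/
theorem support_eq_empty_of_confinedGE_succ {X Y : Scheme.{0}} (f : X ⟶ Y) (M : MarkedIdeal X) {d : ℕ}
    (hdim : topologicalKrullDim Y ≤ ((d : ℕ) : WithBot ℕ∞)) (h : ConfinedGE f M (d + 1)) : M.support = ∅ := by
  refine Set.eq_empty_iff_forall_notMem.mpr fun z hz => ?_
  have h1 : (((d + 1 : ℕ) : ℕ) : WithBot ℕ∞) ≤ ((d : ℕ) : WithBot ℕ∞) :=
    (h z hz).trans (ringKrullDim_stalk_le_of_dim_le hdim (f.base z))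
  have h2 : d + 1 ≤ d := by exact_mod_cast h1
  omega

/-- On a scheme of dimension `≤ d`, reaching confinement over codimension `≥ d+1` IS a weak resolution. [folklore] -/
theorem weakResolution_of_reachConfined_succ {Y : Scheme.{0}} {d : ℕ}
    (hdim : topologicalKrullDim Y ≤ ((d : ℕ) : WithBot ℕ∞)) {I : Y.IdealSheafData} {n : ℕ}
    (h : ReachConfined I n (d + 1)) : ∃ t : CentreSeq Y, WeakResolution t (⟨I, [], n⟩ : MarkedIdeal Y) := by
  obtain ⟨t, hA, hC⟩ := h
  exact ⟨t, hA, support_eq_empty_of_confinedGE_succ _ _ hdim hC⟩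

/-- **BY LETTER the rounds of dimension d+1 contain the whole dimension-d problem** (a d-fold is a (d+1)-fold of
dimension ≤ d+1; confinement over codimension ≥ d+1 on it is an empty top locus). [folklore] -/
theorem seqDim_of_reachClosed_succ {d n : ℕ} (h : ReachClosed (d + 1) n) : SeqDim d n := by
  intro p hp k _ _ Y g hg1 hg2 hg3 hY hYd I hord
  exact weakResolution_of_reachConfined_succ hYd
    (h p hp k Y g hg1 hg2 hg3 hY (hYd.trans (by exact_mod_cast Nat.le_succ d)) I hord)

/-- By letter: g7's first round (dim 4) contains the whole SURFACE problem. [folklore] -/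
theorem seqDim_two_of_roundCodimTwo {n : ℕ} (h : RoundCodimTwo n) : SeqDim 2 n := by
  intro p hp k _ _ Y g hg1 hg2 hg3 hY hY2 I hord
  exact weakResolution_of_reachConfined_succ hY2
    (h p hp k Y g hg1 hg2 hg3 hY (hY2.trans (by exact_mod_cast (show 2 ≤ 4 by norm_num))) I hord)

/-- By letter: g7's second round (dim 4, general) contains the THREEFOLD CLOSED-POINT CORE (restrict to `dim Y ≤ 3`:
the hypothesis «confined over codimension ≥ 3» is closed-point confinement there, and the conclusion «confined over
codimension ≥ 4» is an empty top locus). [folklore] -/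
theorem closedCoreThree_of_roundCodimThree {n : ℕ} (h : RoundCodimThree n) : ClosedCore 3 n := by
  intro p hp k _ _ Y g hg1 hg2 hg3 hY hY3 I hord hR
  exact weakResolution_of_reachConfined_succ hY3
    (h p hp k Y g hg1 hg2 hg3 hY (hY3.trans (by exact_mod_cast (show 3 ≤ 4 by norm_num))) I hord hR)

/-! ## §2 THE DICTIONARY — two ports (costume by shape, counted 0) and the surface port -/

/-- **PORT · COSTUME(cite) · the generic-fibre dictionary, dim 3 ⟶ dim 4** `DictThree n`: weak order reduction for
ALL dim-3 data over ALL fields of char p gives, for every dim-4 datum, a weakly admissible history confining the top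
locus over CLOSED points.  CONTENT: (i) divisorial components `D` of a top locus are regular (`I_t ⊆ 𝓘_D^n`, `ord ≤ n`
⇒ `ord 𝓘_D = 1`; regular local rings are UFDs) and are divided out by blowing them up (isomorphisms); (ii) the
non-closed, non-divisorial points of `Y` under the top locus are finitely many, `η₁,…,η_m` (codimension 2 or 3); for
each, an affine `U ∋ η` and `f ∈ Γ(U, 𝒪)` transcendental in `κ(η)` give `U → 𝔸¹_k` with generic fibre `U_ξ`, a regular
separated finite-type `K := k(f)`-scheme of dimension 3 containing `η` with `𝒪_{U_ξ,η} = 𝒪_{Y,η}` (Mathlib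
`AlgebraicGeometry.FunctionField`; tree `Literature.AlgebraicGeometry.Limits.GenericFibreSpread`); the current state
`W_ξ := (Y_t|_U)_ξ` is regular, separated, of finite type over `K`, of dimension 3, and carries the current transform
`(I_t, n)|_{W_ξ}` with `ord ≤ n` — a dim-3 datum over the field `K` (char p), to which `SeqDim 3 n` applies; (iii) its
weak resolution spreads over an open `V ∋ ξ` (EGA IV-3 8.8.2/8.10.5: centres, their regularity, containment in the top
locus, blow-ups and the emptiness of the final top locus are of finite presentation; the tree's BGMW toolkit
`EffectiveResolutionSpreadModel` / `GenericFibreResolutionDatum` is this argument for `𝔸ⁿ_A → Spec A`), and globalises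
to `Y_t`: closures of point-centres are curves, of curve-centres surfaces — regularised INSIDE the top locus by CJS
(tree `CossartJannsenSaito2020EmbeddedSequenceB`, dim ≤ 2, blow-ups over the complement of `f⁻¹V`, weakly
permissible) — of surface-centres divisorial components, regular by (i); flat base change identifies the transforms
over `f⁻¹V`; (iv) along weakly permissible blow-ups the order does not increase (char-free), so the image of the top
locus in `Y` only SHRINKS: the finite set of non-closed image points loses `η` and gains nothing — induction.  The
same dictionary with `𝔸^{4-c}` in place of `𝔸¹` treats a codimension-c point through a `c`-fold over
`k(t₁,…,t_{4-c})`; `𝔸¹` suffices since `SeqDim 3 n ⊇ SeqDim 2 n`.  Leaf: ATTACKABLE (port, size L; typed tools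
named above). (Sources: EGA IV-3 §8; arXiv:math/0703678 Prop 2.3.4, Lemma 2.1.1;
BierstoneGrigorievMilmanWlodarczyk2011 §3.3; CossartJannsenSaito2020 Cor 1.5.) -/
def DictThree (n : ℕ) : Prop := SeqDim 3 n → ReachClosed 4 n

/-- **PORT · COSTUME(cite) · the dictionary, dim 2 ⟶ dim 3** `DictTwo n`: the same one dimension down (generic fibres
of `U → 𝔸¹_K` are regular SURFACES over `K(f)`; closures of point-centres are curves, CJS-regularised inside the top
locus; curve-centres ↦ divisorial components, regular).  (Sources: EGA IV-3 §8; arXiv:math/0703678 Prop 2.3.4;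
CossartJannsenSaito2020 Cor 1.5.) -/
def DictTwo (n : ℕ) : Prop := SeqDim 2 n → ReachClosed 3 n

/-- **PORT · COSTUME(cite) · KNOWN-MOD-PORT(S)** `SurfacePort n`: Cutkosky2009 Thm 6.1 (tree NAMED FACT
`Cutkosky2009_thm_6_1`: ANY field `L`, `T` an integral regular quasi-projective surface over `L`, any snc boundary,
`I ≠ 0`, `r ≥ 1`, `ν ≤ r` everywhere ⇒ marked resolution, weak transforms) gives `SeqDim 2 n` (`n ≥ 1`).  Content:
connected components of a regular `Y` are integral; a regular separated finite-type surface over a field is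
quasi-projective (regular complete surfaces are projective, Zariski; Nagata compactification + surface resolution,
Lipman1978); `I = 0` on a component means `ord = ⊤ > n`, excluded; `IsMarkedResolution` (a composite of permissible
blow-ups with `Sing_r = ∅` at the end) ↦ `∃ t : CentreSeq, WeakResolution t` (centres inside `Sing_r` = top locus,
weak = controlled transforms at marking `r`).  (Sources: Cutkosky2009 Thm 6.1 (p.19), Rem 6.2; Lipman1978.) -/
def SurfacePort (n : ℕ) : Prop := Cutkosky2009_thm_6_1.{0} → SeqDim 2 n

/-! ## §3 The g8 pieces and the EXACT cut modulo the dictionary -/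

/-- The g8 pieces at marking `n`: the DECIDED surface base and the closed-point cores of dimensions 3 and 4. -/
def GPieces (n : ℕ) : Prop := SeqDim 2 n ∧ ClosedCore 3 n ∧ ClosedPointCore n

/-- By letter: the target gives every g8 piece. [folklore] -/
theorem gPieces_of_seq {n : ℕ} (h : SeqDimFour 1 n) : GPieces n :=
  have h4 : SeqDim 4 n := (seqDim_four_iff n).mpr h
  ⟨seqDim_mono (by norm_num) h4, closedCore_of_seqDim (seqDim_mono (by norm_num) h4),
    (closedCore_four_iff n).mp (closedCore_of_seqDim h4)⟩

/-- Dimension 3 from its pieces: the surface base (through the dictionary) and the threefold closed-point core.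
[folklore] -/
theorem seqDim_three_of_pieces {n : ℕ} (d2 : DictTwo n) (h2 : SeqDim 2 n) (c3 : ClosedCore 3 n) : SeqDim 3 n :=
  seqDim_of_reachClosed_of_closedCore (d2 h2) c3

/-- **ASSEMBLY (g8)**: modulo the two dictionary ports, the surface base and the two closed-point cores give weak
order reduction for ALL dim-4 data at marking `n`. [folklore] -/
theorem seq_of_gPieces {n : ℕ} (d3 : DictThree n) (d2 : DictTwo n) (h : GPieces n) : SeqDimFour 1 n :=
  (seqDim_four_iff n).mp
    (seqDim_of_reachClosed_of_closedCore (d3 (seqDim_three_of_pieces d2 h.1 h.2.1))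
      ((closedCore_four_iff n).mpr h.2.2))

/-- **EXACTNESS (g8)** modulo the dictionary: the dim-4 E-problem at marking `n` IS «surfaces» ∧ «threefold
closed-point core» ∧ «fourfold closed-point core», all over ALL fields of characteristic p. [folklore] -/
theorem seq_iff_gPieces {n : ℕ} (d3 : DictThree n) (d2 : DictTwo n) : SeqDimFour 1 n ↔ GPieces n :=
  ⟨gPieces_of_seq, seq_of_gPieces d3 d2⟩

/-- The g8 pieces give the g7 pieces (modulo the dictionary) … [folklore] -/
theorem pieces_of_gPieces {n : ℕ} (d3 : DictThree n) (d2 : DictTwo n) (h : GPieces n) : Pieces n :=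
  (seq_iff_rounds n).mp (seq_of_gPieces d3 d2 h)

/-- … and conversely BY LETTER (no port): g7's rounds contain the surface problem and the threefold closed-point
core. [folklore] -/
theorem gPieces_of_pieces {n : ℕ} (h : Pieces n) : GPieces n :=
  ⟨seqDim_two_of_roundCodimTwo h.1, closedCoreThree_of_roundCodimThree h.2.1, h.2.2⟩

/-- LATTICE: modulo the dictionary and the decided surface base, g7's CP-sized round `RoundCodimThree n` IS the
threefold closed-point core (⟸ needs the ports; ⟹ is by letter). [folklore] -/
theorem roundCodimThree_iff_closedCoreThree {n : ℕ} (d3 : DictThree n) (d2 : DictTwo n) (h2 : SeqDim 2 n) :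
    RoundCodimThree n ↔ ClosedCore 3 n :=
  ⟨closedCoreThree_of_roundCodimThree,
    fun c3 => ((reachClosed_four_iff_rounds n).mp (d3 (seqDim_three_of_pieces d2 h2 c3))).2⟩

/-- LATTICE: modulo the dictionary, the decided base and the threefold core, the fourfold closed-point core IS the
target (the cut relocates the open problem onto closed fibres; stated so that the critic need not discover it).
[folklore] -/
theorem closedPointCore_iff_seq {n : ℕ} (d3 : DictThree n) (d2 : DictTwo n) (h2 : SeqDim 2 n) (c3 : ClosedCore 3 n) :
    ClosedPointCore n ↔ SeqDimFour 1 n :=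
  ⟨fun c4 => seq_of_gPieces d3 d2 ⟨h2, c3, c4⟩, closedPointCore_of_seq⟩

/-! ## §4 THE p-RANK LADDER — the special/generic content made quantitative (perfect column) -/

/-- **`PRankLE p K r`** — the field `K` (char p) has p-rank `≤ r`, i.e. `[K : K^p] ≤ p^r`: some `r` elements
`b₁,…,b_r` generate `K` over `K^p` (every `x` is a `K^p`-combination of monomials in the `b_i`).  `r = 0` ⟺ `K`
perfect (`pRankLE_zero_of_perfectField`); `K ↦ K(t)` raises the p-rank by exactly one and finite extensions
preserve it (Matsumura1987 §26, Thm 26.7/26.10), so residue fields of closed points of `K`-varieties have the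
p-rank of `K`. DEFINITION (the grading parameter of the lens: special = p-rank 0 = perfect, generic = p-rank 4−c at
codimension c). (Sources: Matsumura1987 §26.) -/
def PRankLE (p : ℕ) (K : Type) [Field K] (r : ℕ) : Prop :=
  ∃ b : Fin r → K, ∀ x : K, ∃ c : (Fin r →₀ ℕ) →₀ K, x = c.sum fun m a => a ^ p * ∏ i, b i ^ (m i)

/-- A perfect field has p-rank 0. [folklore] -/
theorem pRankLE_zero_of_perfectField {p : ℕ} (hp : p.Prime) (K : Type) [Field K] [CharP K p] [PerfectField K] :
    PRankLE p K 0 := by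
  haveI : ExpChar K p := ExpChar.prime hp
  refine ⟨Fin.elim0, fun x => ?_⟩
  obtain ⟨y, hy⟩ := surjective_frobenius K p x
  refine ⟨Finsupp.single 0 y, ?_⟩
  rw [Finsupp.sum_single_index (by simp [hp.ne_zero])]
  simp [← hy, frobenius_def]

/-- **`SeqDimP d r n`** — `SeqDim d n` over ground fields of p-rank `≤ r`.  `SeqDimP 4 0 n ⟹ SeqDimFourPerfect 1 n`
(`seqDimFourPerfect_of_seqDimP_zero`); `SeqDimP 3 1 n` = weak order reduction for all dim-3 data over fields of p-RANK
ONE — the entire imperfect-field input of the perfect-column dim-4 E-problem (`perfectColumn_of_pieces`).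
(Sources: CossartPiltant2008; CossartPiltant2019; BenitoVillamayor2012.) -/
def SeqDimP (d r n : ℕ) : Prop :=
  ∀ p : ℕ, p.Prime → ∀ (k : Type) [Field k] [CharP k p], PRankLE p k r →
    ∀ (Y : Scheme.{0}) (g : Y ⟶ Spec (.of k)), IsSeparated g → LocallyOfFiniteType g → QuasiCompact g →
    Scheme.IsRegular Y → topologicalKrullDim Y ≤ ((d : ℕ) : WithBot ℕ∞) →
    ∀ I : Y.IdealSheafData, (∀ y : Y, idealOrder I y ≤ ((n : ℕ) : ℕ∞)) →
      ∃ t : CentreSeq Y, WeakResolution t (⟨I, [], n⟩ : MarkedIdeal Y)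

/-- **`ReachClosedP d r n`** — `ReachClosed d n` over ground fields of p-rank `≤ r`. -/
def ReachClosedP (d r n : ℕ) : Prop :=
  ∀ p : ℕ, p.Prime → ∀ (k : Type) [Field k] [CharP k p], PRankLE p k r →
    ∀ (Y : Scheme.{0}) (g : Y ⟶ Spec (.of k)), IsSeparated g → LocallyOfFiniteType g → QuasiCompact g →
    Scheme.IsRegular Y → topologicalKrullDim Y ≤ ((d : ℕ) : WithBot ℕ∞) →
    ∀ I : Y.IdealSheafData, (∀ y : Y, idealOrder I y ≤ ((n : ℕ) : ℕ∞)) →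
      ReachConfined I n d

/-- **`ClosedCoreP d r n`** — the closed-point core of dimension `d` over ground fields of p-rank `≤ r`; the residue
fields of the finitely many closed points it lives over have p-rank `≤ r` (PERFECT for `r = 0`: `ClosedCoreP 4 0 n` is
the located residual of the perfect column; `ClosedCoreP 3 1 n` the threefold core over p-rank-one fields). -/
def ClosedCoreP (d r n : ℕ) : Prop :=
  ∀ p : ℕ, p.Prime → ∀ (k : Type) [Field k] [CharP k p], PRankLE p k r →
    ∀ (Y : Scheme.{0}) (g : Y ⟶ Spec (.of k)), IsSeparated g → LocallyOfFiniteType g → QuasiCompact g →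
    Scheme.IsRegular Y → topologicalKrullDim Y ≤ ((d : ℕ) : WithBot ℕ∞) →
    ∀ I : Y.IdealSheafData, (∀ y : Y, idealOrder I y ≤ ((n : ℕ) : ℕ∞)) →
      ReachConfined I n d → ∃ t : CentreSeq Y, WeakResolution t (⟨I, [], n⟩ : MarkedIdeal Y)

/-- **PORT · COSTUME(cite) · graded dictionary dim 3 ⟶ dim 4**: `DictThree` consumes the dim-3 statement only over the
fields `k(f)`, of p-rank one more than `k`.  (Sources: EGA IV-3 §8; Matsumura1987 §26.) -/
def DictThreeP (r n : ℕ) : Prop := SeqDimP 3 (r + 1) n → ReachClosedP 4 r n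

/-- **PORT · COSTUME(cite) · graded dictionary dim 2 ⟶ dim 3**.  (Sources: EGA IV-3 §8; Matsumura1987 §26.) -/
def DictTwoP (r n : ℕ) : Prop := SeqDimP 2 (r + 2) n → ReachClosedP 3 (r + 1) n

/-- By letter: the all-fields statement gives every p-rank slice. [folklore] -/
theorem seqDimP_of_seqDim {d r n : ℕ} (h : SeqDim d n) : SeqDimP d r n := by
  intro p hp k _ _ _ Y g hg1 hg2 hg3 hY hYd I hord
  exact h p hp k Y g hg1 hg2 hg3 hY hYd I hord

/-- By letter: the all-fields closed-point core gives every p-rank slice. [folklore] -/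
theorem closedCoreP_of_closedCore {d r n : ℕ} (h : ClosedCore d n) : ClosedCoreP d r n := by
  intro p hp k _ _ _ Y g hg1 hg2 hg3 hY hYd I hord hR
  exact h p hp k Y g hg1 hg2 hg3 hY hYd I hord hR

/-- Graded assembly in dimension d. [folklore] -/
theorem seqDimP_of_reachClosedP_of_closedCoreP {d r n : ℕ} (hR : ReachClosedP d r n) (hC : ClosedCoreP d r n) :
    SeqDimP d r n := by
  intro p hp k _ _ hk Y g hg1 hg2 hg3 hY hYd I hord
  exact hC p hp k hk Y g hg1 hg2 hg3 hY hYd I hord (hR p hp k hk Y g hg1 hg2 hg3 hY hYd I hord)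

/-- **THE p-RANK LADDER**: over ground fields of p-rank `≤ r`, the dim-4 E-problem at marking `n` follows from the
fourfold closed-point core over p-rank `≤ r`, the THREEFOLD closed-point core over p-rank `≤ r+1` and SURFACES over
p-rank `≤ r+2`, modulo the graded dictionary. [folklore] -/
theorem seqDimP_four_of_pieces {r n : ℕ} (d3 : DictThreeP r n) (d2 : DictTwoP r n) (h2 : SeqDimP 2 (r + 2) n)
    (c3 : ClosedCoreP 3 (r + 1) n) (c4 : ClosedCoreP 4 r n) : SeqDimP 4 r n :=
  seqDimP_of_reachClosedP_of_closedCoreP (d3 (seqDimP_of_reachClosedP_of_closedCoreP (d2 h2) c3)) c4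

/-- The p-rank-0 slice IS the tree's perfect slice `SeqDimFourPerfect 1 n` (perfect fields have p-rank 0).
[folklore] -/
theorem seqDimFourPerfect_of_seqDimP_zero {n : ℕ} (h : SeqDimP 4 0 n) : SeqDimFourPerfect 1 n := by
  intro p hp k _ _ _ Y g hg1 hg2 hg3 hY hY4 I hord _
  exact h p hp k (pRankLE_zero_of_perfectField hp k) Y g hg1 hg2 hg3 hY (by exact_mod_cast hY4) I hord

/-- **THE PERFECT COLUMN through the dictionary**: the perfect-field dim-4 E-problem at marking `n` (tree
`SeqDimFourPerfect 1 n`, lens-5 g6's Perfect column in sequence form) follows from the fourfold closed-point core over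
PERFECT fields (closed points with perfect residue fields), the threefold closed-point core over fields of p-RANK ONE,
and surfaces over fields of p-rank two (decided for every field) — modulo the graded dictionary. [folklore] -/
theorem perfectColumn_of_pieces {n : ℕ} (d3 : DictThreeP 0 n) (d2 : DictTwoP 0 n) (h2 : SeqDimP 2 2 n)
    (c3 : ClosedCoreP 3 1 n) (c4 : ClosedCoreP 4 0 n) : SeqDimFourPerfect 1 n :=
  seqDimFourPerfect_of_seqDimP_zero (seqDimP_four_of_pieces d3 d2 h2 c3 c4)

/-- The perfect column from the ALL-fields pieces of §3 (by letter) and the graded ports. [folklore] -/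
theorem perfectColumn_of_gPieces {n : ℕ} (d3 : DictThreeP 0 n) (d2 : DictTwoP 0 n) (h : GPieces n) :
    SeqDimFourPerfect 1 n :=
  perfectColumn_of_pieces d3 d2 (seqDimP_of_seqDim h.1) (closedCoreP_of_closedCore h.2.1)
    (closedCoreP_of_closedCore ((closedCore_four_iff n).mpr h.2.2))

end Summit.ResolutionOfSingularities.ResolutionOfSingularities.Theorems.GenericFibreCutClasses
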